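import Literature.NumberTheory.EllipticCurves.CoatesGreenberg1996.GoodModelKernelH1Trivial
import Literature.NumberTheory.EllipticCurves.UnramifiedCoboundaryInputs
import Mathlib.GroupTheory.GroupAction.Quotient
import Literature.NumberTheory.EllipticCurves.CoatesGreenberg1996.DeeplyRamifiedTrace
import Literature.NumberTheory.EllipticCurves.CoatesGreenberg1996.GoodModelFormalH1AlmostEtale
import Literature.NumberTheory.EllipticCurves.CoatesGreenberg1996.CyclotomicZpExtensionDeeplyRamifiedProofs
import HarnessLib

/-!
# `H1_goodModelKernel_trivial` and (I2) `CoatesGreenberg1996_H1_formalGroup_trivial` HOLD (universe `0`) — the good-model kernel `H¹` cone re-homed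

Family `bsd` material RE-HOMED into `Literature/` by the Hodge foundations lane (`lit-hodgefound`, seat p20,
generation 35): verbatim ports of `Summits/BirchSwinnertonDyer/Rank1Residual/Additive/{GoodModelKernelH1Layer,
GoodModelKernelH1Transport, GoodModelKernelH1OfDeeplyRamified}.lean` (cell `b2b-bsdres`, seat n1011-p05; Parts 1–3 below, in
this order, each with its original module docstring), namespace `Summit.BirchSwinnertonDyer.Rank1Residual.Additive.GoodModelLine.KernelH1`
re-rooted as `Literature.NumberTheory.EllipticCurves.CoatesGreenberg1996.GoodModelLine.KernelH1`; the two `_root_`-named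
reductions of the original (`CoatesGreenberg1996.H1_goodModelKernel_trivial_of_deeplyRamifiedTrace`,
`WeierstrassCurve.CoatesGreenberg1996_H1_formalGroup_trivial_of_deeplyRamifiedTrace`, names owned by the Summits file) are
kept INSIDE the new namespace.  Theorems only (no definition, no named fact), imports Literature/Mathlib only.  Part 4 is new:
the EXACT discharges (universe `0`, the honest scope of the base instance `deeplyRamified_cyclotomicZpExtension_trace_holds`,
Tate's almost étale lemma) `CoatesGreenberg1996.H1_goodModelKernel_trivial_holds` ([CoGr] Cor. 3.2 for good models, cocycle
form) and `WeierstrassCurve.CoatesGreenberg1996_H1_formalGroup_trivial_holds` (Greenberg's input (I2) at a supersingular prime,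
LNM 1716 p. 83 = [CoGr] Cor. 3.2), from the trace form of "deeply ramified" `deeplyRamified_cyclotomic_trace_holds` (`CyclotomicZpExtensionDeeplyRamifiedProofs` §4).
Summits-side twins: `Summit.BirchSwinnertonDyer.BirchSwinnertonDyer.Theorems.{H1_goodModelKernel_trivial_holds,
CoatesGreenberg1996_H1_formalGroup_trivial_holds}` (file `ThetaPartnerAtTwoSignedControlAtTwoCoatesGreenbergUnconditional`).
BSD is not proved by any of this; nothing here closes an item.

References: [CoatesGreenberg1996] §2 p. 143, Thm. 2.13, §3 Thm. 3.1 / Cor. 3.2; [IovitaZaharescu1999] Thm. 1.2;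
[GreenbergLNM1716] pp. 27, 36–37, 83–84; [Bondarko2007FormalGroupsSurvey] Thm. 9.2; [SilvermanAEC2009] VII.2.1–2.2; [Tate1967] §3.2 Prop. 9.
-/

noncomputable section

/-!
## Part 1 — port of `Summits/BirchSwinnertonDyer/Rank1Residual/Additive/GoodModelKernelH1Layer.lean`

# The finite Galois-stable layer of the almost-étale argument: subgroups `G ∩ Gal(K̄_v/M)` of
# finite index, the orbit field `M(G • x)`, its `G`-stability and its pointwise stabiliser
# (Galois bookkeeping for the END `GoodModelKernelH1OfDeeplyRamified`)

HONEST FRAMING (BSD rank-`≤ 1` residual cell `b2b-bsdres`, home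
`run/shared/lean/b2b/bsd-rank1-residual/`, team n1011, seat n1011-p05 GEN 9, row T-CG-DR, skeleton
`cells/n1011/skel/T-CG-DR.md`): the cell deletes the COMBINATION-SHAPED residual classes of the
rank-`≤ 1` BSD formula from PUBLISHED theorems only and TYPES the construction-shaped ones;
research route, no claim beyond the stated classes, census output = EVIDENCE, nothing booked, no
mark moves. TOOL file (theorems only, no definition, no named fact): infinite Galois theory of
`K̄_v/K_v` (Krull topology, Mathlib `InfiniteGalois`) in the shape consumed by the derivation of
the Coates–Greenberg record from the trace form of "deeply ramified".

## Contents (all over `(absoluteGaloisGroup (v.adicCompletion K))_{K_v} = Gal(K̄_v/K_v)`, `K_v = v.adicCompletion K`)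

* `fixingSubgroup_comap_normal`, `finite_quotient_subgroupOf_fixingSubgroup` — for a finite NORMAL
  `M/K_v`, `Gal(K̄_v/M)` is normal in `(absoluteGaloisGroup (v.adicCompletion K))_{K_v}` and `G/(G ∩ Gal(K̄_v/M))` is finite for every
  `G ≤ (absoluteGaloisGroup (v.adicCompletion K))_{K_v}` (it embeds in `Aut(M/K_v)`).
* `finite_coords` — the coordinates of finitely many affine points form a finite set.
* `mem_iff_forall_smul_eq` — `z ∈ Kn ↔ z` is fixed by `Gal(K̄_v/Kn)` (`fixedField ∘ fixingSubgroup`).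
* `smul_mem_orbitLayer`, `smul_eq_self_of_mem_orbitLayer` — for `M` finite normal, `G ≤ (absoluteGaloisGroup (v.adicCompletion K))_{K_v}`,
  `U = G ∩ Gal(K̄_v/M)` and `x` fixed by `U`, the layer `Kn = M ⊔ K_v(q.out • x : q ∈ G/U)` is
  `G`-stable and fixed pointwise by `U`.

References: J. Neukirch, *ANT* IV §1 (Krull topology) [NeukirchANT1999]; Mathlib
`FieldTheory.Galois.Infinite`, `FieldTheory.KrullTopology`, `FieldTheory.Normal.Closure`.
-/

section Part1


open scoped Classical NNReal

open WeierstrassCurve NumberField IsDedekindDomain Field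
  Literature.NumberTheory.GaloisRepresentations Literature.NumberTheory.EllipticCurves
  IsDedekindDomain.HeightOneSpectrum

universe u

namespace Literature.NumberTheory.EllipticCurves.CoatesGreenberg1996.GoodModelLine.KernelH1

/-! ## §1 Finitely many points have finitely many coordinates -/

/-- The set of coordinates of the affine points in a finite set of points is finite. [folklore] -/
private theorem finite_coords {F : Type*} [Field F] {V : WeierstrassCurve F} {Ps : Set V.toAffine.Point}
    (hPs : Ps.Finite) :
    {z | ∃ P ∈ Ps, ∃ x y, ∃ h : V.toAffine.Nonsingular x y, P = .some x y h ∧ (z = x ∨ z = y)}.Finite := by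
  have hsub : {z | ∃ P ∈ Ps, ∃ x y, ∃ h : V.toAffine.Nonsingular x y, P = .some x y h ∧ (z = x ∨ z = y)} ⊆
      ⋃ P ∈ Ps, {z | ∃ x y, ∃ h : V.toAffine.Nonsingular x y, P = .some x y h ∧ (z = x ∨ z = y)} := by
    intro z hz
    obtain ⟨P, hP, hrest⟩ := hz
    exact Set.mem_biUnion hP hrest
  refine Set.Finite.subset (Set.Finite.biUnion hPs fun P _ ↦ ?_) hsub
  rcases P with _ | ⟨x, y, h⟩
  · convert Set.finite_empty
    ext z
    simp only [Set.mem_setOf_eq, Set.mem_empty_iff_false, iff_false, not_exists]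
    intro x y h hh
    exact WeierstrassCurve.Affine.Point.some_ne_zero _ hh.1.symm
  · refine Set.Finite.subset (Set.toFinite ({x, y} : Set _)) fun z hz ↦ ?_
    obtain ⟨x', y', h', hP', hz⟩ := hz
    simp only [WeierstrassCurve.Affine.Point.some.injEq] at hP'
    obtain ⟨rfl, rfl⟩ := hP'
    rcases hz with rfl | rfl
    · exact Set.mem_insert _ _
    · exact Set.mem_insert_of_mem _ rfl

/-! ## §2 Galois bookkeeping in `(absoluteGaloisGroup (v.adicCompletion K))_{K_v}` -/

section Galois

variable {K : Type u} [Field K] [NumberField K] {v : HeightOneSpectrum (𝓞 K)}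

/-- The fixing subgroup of a NORMAL intermediate field `M/K_v` of `K̄_v`, viewed in `(absoluteGaloisGroup (v.adicCompletion K))_{K_v}`, is a
normal subgroup (it is the kernel of the restriction to `M`). [folklore] -/
private theorem fixingSubgroup_comap_normal (M : IntermediateField (v.adicCompletion K) (AlgebraicClosure (v.adicCompletion K)))
    [Normal (v.adicCompletion K) M] : (M.fixingSubgroup.comap (absoluteGaloisGroup.toAlgEquiv (v.adicCompletion K)).toMonoidHom).Normal := by
  haveI : M.fixingSubgroup.Normal := by
    rw [← M.restrictNormalHom_ker]
    exact MonoidHom.normal_ker _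
  exact Subgroup.Normal.comap inferInstance _

/-- For a finite normal `M/K_v` inside `K̄_v` and any subgroup `G ≤ (absoluteGaloisGroup (v.adicCompletion K))_{K_v}`, the quotient
`G / (G ∩ Gal(K̄_v/M))` is finite (it embeds in `Aut(M/K_v)`). [folklore] -/
private theorem finite_quotient_subgroupOf_fixingSubgroup (M : IntermediateField (v.adicCompletion K) (AlgebraicClosure (v.adicCompletion K)))
    [FiniteDimensional (v.adicCompletion K) M] [Normal (v.adicCompletion K) M] (G : Subgroup (absoluteGaloisGroup (v.adicCompletion K))) :
    Finite (G ⧸ (M.fixingSubgroup.comap (absoluteGaloisGroup.toAlgEquiv (v.adicCompletion K)).toMonoidHom).subgroupOf G) := by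
  set f : G →* (M ≃ₐ[v.adicCompletion K] M) :=
    (AlgEquiv.restrictNormalHom M).comp ((absoluteGaloisGroup.toAlgEquiv (v.adicCompletion K)).toMonoidHom.comp G.subtype) with hf
  have hker : f.ker = (M.fixingSubgroup.comap (absoluteGaloisGroup.toAlgEquiv (v.adicCompletion K)).toMonoidHom).subgroupOf G := by
    rw [hf, ← MonoidHom.comap_ker, M.restrictNormalHom_ker, ← Subgroup.comap_comap]
    rfl
  rw [← hker]
  exact Finite.of_equiv _ (QuotientGroup.quotientKerEquivRange f).symm.toEquiv

/-- **Galois descent to an intermediate field**: `z ∈ Kn` iff `z` is fixed by every `τ ∈ (absoluteGaloisGroup (v.adicCompletion K))_{K_v}`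
fixing `Kn` pointwise (`InfiniteGalois.fixedField_fixingSubgroup`). [folklore] -/
private theorem mem_iff_forall_smul_eq (Kn : IntermediateField (v.adicCompletion K) (AlgebraicClosure (v.adicCompletion K))) (z : (AlgebraicClosure (v.adicCompletion K))) :
    z ∈ Kn ↔ ∀ τ : (absoluteGaloisGroup (v.adicCompletion K)), absoluteGaloisGroup.toAlgEquiv (v.adicCompletion K) τ ∈ Kn.fixingSubgroup → τ • z = z := by
  haveI := isGalois_algebraicClosure_adicCompletion (v := v)
  constructor
  · intro hz τ hτ
    rw [IntermediateField.mem_fixingSubgroup_iff] at hτ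
    exact hτ z hz
  · intro h
    rw [← InfiniteGalois.fixedField_fixingSubgroup Kn, IntermediateField.mem_fixedField_iff]
    intro f hf
    exact h ((absoluteGaloisGroup.toAlgEquiv (v.adicCompletion K)).symm f) (by rw [MulEquiv.apply_symm_apply]; exact hf)

/-- Every `k • x`, `k ∈ G`, is one of the `q.out • x`, `q ∈ G/U`, when `U = G ∩ Gal(K̄_v/M)` fixes
`x`. [folklore] -/
private theorem smul_mem_range_out_smul (M : IntermediateField (v.adicCompletion K) (AlgebraicClosure (v.adicCompletion K))) (G : Subgroup (absoluteGaloisGroup (v.adicCompletion K)))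
    (x : (AlgebraicClosure (v.adicCompletion K))) (hxU : ∀ u ∈ M.fixingSubgroup.comap (absoluteGaloisGroup.toAlgEquiv (v.adicCompletion K)).toMonoidHom ⊓ G, u • x = x) (k : G) :
    (k : (absoluteGaloisGroup (v.adicCompletion K))) • x ∈ Set.range fun q : G ⧸ (M.fixingSubgroup.comap (absoluteGaloisGroup.toAlgEquiv (v.adicCompletion K)).toMonoidHom).subgroupOf G ↦
      ((q.out : G) : (absoluteGaloisGroup (v.adicCompletion K))) • x := by
  obtain ⟨u, hu⟩ := QuotientGroup.mk_out_eq_mul ((M.fixingSubgroup.comap (absoluteGaloisGroup.toAlgEquiv (v.adicCompletion K)).toMonoidHom).subgroupOf G) k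
  refine ⟨QuotientGroup.mk k, ?_⟩
  change (((QuotientGroup.mk k : G ⧸ _).out : G) : (absoluteGaloisGroup (v.adicCompletion K))) • x = _
  rw [hu, Subgroup.coe_mul, mul_smul, hxU u ⟨Subgroup.mem_subgroupOf.mp u.2, u.1.2⟩]

/-- **`G`-stability of the layer `Kn = M ⊔ K_v(G • x)`** (`M` normal, so `(absoluteGaloisGroup (v.adicCompletion K))`-stable; the orbit is
permuted by `G`). [folklore] -/
private theorem smul_mem_orbitLayer (M : IntermediateField (v.adicCompletion K) (AlgebraicClosure (v.adicCompletion K)))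
    [Normal (v.adicCompletion K) M] (G : Subgroup (absoluteGaloisGroup (v.adicCompletion K))) (x : (AlgebraicClosure (v.adicCompletion K)))
    (hxU : ∀ u ∈ M.fixingSubgroup.comap (absoluteGaloisGroup.toAlgEquiv (v.adicCompletion K)).toMonoidHom ⊓ G, u • x = x) (g : G) {z : (AlgebraicClosure (v.adicCompletion K))}
    (hz : z ∈ M ⊔ IntermediateField.adjoin (v.adicCompletion K)
      (Set.range fun q : G ⧸ (M.fixingSubgroup.comap (absoluteGaloisGroup.toAlgEquiv (v.adicCompletion K)).toMonoidHom).subgroupOf G ↦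
        ((q.out : G) : (absoluteGaloisGroup (v.adicCompletion K))) • x)) :
    (g : (absoluteGaloisGroup (v.adicCompletion K))) • z ∈ M ⊔ IntermediateField.adjoin (v.adicCompletion K)
      (Set.range fun q : G ⧸ (M.fixingSubgroup.comap (absoluteGaloisGroup.toAlgEquiv (v.adicCompletion K)).toMonoidHom).subgroupOf G ↦
        ((q.out : G) : (absoluteGaloisGroup (v.adicCompletion K))) • x) := by
  set ĝ : (AlgebraicClosure (v.adicCompletion K)) ≃ₐ[v.adicCompletion K] (AlgebraicClosure (v.adicCompletion K)) := absoluteGaloisGroup.toAlgEquiv (v.adicCompletion K) (g : (absoluteGaloisGroup (v.adicCompletion K))) with hĝ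
  have hmap : (M ⊔ IntermediateField.adjoin (v.adicCompletion K)
      (Set.range fun q : G ⧸ (M.fixingSubgroup.comap (absoluteGaloisGroup.toAlgEquiv (v.adicCompletion K)).toMonoidHom).subgroupOf G ↦
        ((q.out : G) : (absoluteGaloisGroup (v.adicCompletion K))) • x)).map (ĝ : (AlgebraicClosure (v.adicCompletion K)) →ₐ[v.adicCompletion K] (AlgebraicClosure (v.adicCompletion K))) ≤
      M ⊔ IntermediateField.adjoin (v.adicCompletion K)
        (Set.range fun q : G ⧸ (M.fixingSubgroup.comap (absoluteGaloisGroup.toAlgEquiv (v.adicCompletion K)).toMonoidHom).subgroupOf G ↦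
          ((q.out : G) : (absoluteGaloisGroup (v.adicCompletion K))) • x) := by
    rw [IntermediateField.map_sup]
    refine sup_le_sup ((IntermediateField.normal_iff_forall_map_le'.mp inferInstance) ĝ) ?_
    rw [IntermediateField.adjoin_map]
    refine IntermediateField.adjoin.mono _ _ _ ?_
    rintro _ ⟨_, ⟨q, rfl⟩, rfl⟩
    change ĝ (((q.out : G) : (absoluteGaloisGroup (v.adicCompletion K))) • x) ∈ _
    rw [show ĝ (((q.out : G) : (absoluteGaloisGroup (v.adicCompletion K))) • x) = ((g * q.out : G) : (absoluteGaloisGroup (v.adicCompletion K))) • x by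
      rw [Subgroup.coe_mul, mul_smul]; rfl]
    exact smul_mem_range_out_smul M G x hxU _
  exact hmap ⟨z, hz, rfl⟩

/-- **The layer `Kn = M ⊔ K_v(G • x)` is fixed pointwise by `U = G ∩ Gal(K̄_v/M)`** (`M` normal, so
`Gal(K̄_v/M)` is normal in `(absoluteGaloisGroup (v.adicCompletion K))_{K_v}` and `U` fixes the whole orbit of `x`). [folklore] -/
private theorem smul_eq_self_of_mem_orbitLayer (M : IntermediateField (v.adicCompletion K) (AlgebraicClosure (v.adicCompletion K)))
    [Normal (v.adicCompletion K) M] (G : Subgroup (absoluteGaloisGroup (v.adicCompletion K))) (x : (AlgebraicClosure (v.adicCompletion K)))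
    (hxU : ∀ u ∈ M.fixingSubgroup.comap (absoluteGaloisGroup.toAlgEquiv (v.adicCompletion K)).toMonoidHom ⊓ G, u • x = x) {u : (absoluteGaloisGroup (v.adicCompletion K))}
    (hu : u ∈ M.fixingSubgroup.comap (absoluteGaloisGroup.toAlgEquiv (v.adicCompletion K)).toMonoidHom ⊓ G) {z : (AlgebraicClosure (v.adicCompletion K))}
    (hz : z ∈ M ⊔ IntermediateField.adjoin (v.adicCompletion K)
      (Set.range fun q : G ⧸ (M.fixingSubgroup.comap (absoluteGaloisGroup.toAlgEquiv (v.adicCompletion K)).toMonoidHom).subgroupOf G ↦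
        ((q.out : G) : (absoluteGaloisGroup (v.adicCompletion K))) • x)) :
    u • z = z := by
  haveI hOn := fixingSubgroup_comap_normal M
  set H' : Subgroup ((AlgebraicClosure (v.adicCompletion K)) ≃ₐ[v.adicCompletion K] (AlgebraicClosure (v.adicCompletion K))) :=
    (M.fixingSubgroup.comap (absoluteGaloisGroup.toAlgEquiv (v.adicCompletion K)).toMonoidHom ⊓ G).comap (absoluteGaloisGroup.toAlgEquiv (v.adicCompletion K)).symm.toMonoidHom with hH'def
  have hH'_mem : ∀ f, f ∈ H' ↔ (absoluteGaloisGroup.toAlgEquiv (v.adicCompletion K)).symm f ∈ M.fixingSubgroup.comap (absoluteGaloisGroup.toAlgEquiv (v.adicCompletion K)).toMonoidHom ⊓ G :=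
    fun _ ↦ Subgroup.mem_comap
  have hle : M ⊔ IntermediateField.adjoin (v.adicCompletion K)
      (Set.range fun q : G ⧸ (M.fixingSubgroup.comap (absoluteGaloisGroup.toAlgEquiv (v.adicCompletion K)).toMonoidHom).subgroupOf G ↦
        ((q.out : G) : (absoluteGaloisGroup (v.adicCompletion K))) • x) ≤ IntermediateField.fixedField H' := by
    refine sup_le ?_ ?_
    · rw [IntermediateField.le_iff_le]
      intro f hf
      have h1 : (absoluteGaloisGroup.toAlgEquiv (v.adicCompletion K)).symm f ∈ M.fixingSubgroup.comap (absoluteGaloisGroup.toAlgEquiv (v.adicCompletion K)).toMonoidHom := ((hH'_mem f).mp hf).1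
      rw [Subgroup.mem_comap, MulEquiv.coe_toMonoidHom, MulEquiv.apply_symm_apply] at h1
      exact h1
    · rw [IntermediateField.adjoin_le_iff]
      rintro _ ⟨q, rfl⟩
      rw [SetLike.mem_coe, IntermediateField.mem_fixedField_iff]
      intro f hf
      set τ : (absoluteGaloisGroup (v.adicCompletion K)) := (absoluteGaloisGroup.toAlgEquiv (v.adicCompletion K)).symm f with hτdef
      obtain ⟨hτO, hτG⟩ := (hH'_mem f).mp hf
      change τ • (((q.out : G) : (absoluteGaloisGroup (v.adicCompletion K))) • x) = _
      have hconj : ((q.out : G) : (absoluteGaloisGroup (v.adicCompletion K)))⁻¹ * τ * ((q.out : G) : (absoluteGaloisGroup (v.adicCompletion K))) ∈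
          M.fixingSubgroup.comap (absoluteGaloisGroup.toAlgEquiv (v.adicCompletion K)).toMonoidHom ⊓ G :=
        ⟨hOn.conj_mem' τ hτO _, G.mul_mem (G.mul_mem (G.inv_mem (q.out).2) hτG) (q.out).2⟩
      have := hxU _ hconj
      rw [mul_smul, mul_smul, inv_smul_eq_iff] at this
      exact this
  have hz' := hle hz
  rw [IntermediateField.mem_fixedField_iff] at hz'
  have hmem : absoluteGaloisGroup.toAlgEquiv (v.adicCompletion K) u ∈ H' := by
    rw [hH'_mem, MulEquiv.symm_apply_apply]
    exact hu
  exact hz' _ hmem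

/-- A change of variables is fixed by a ring endomorphism fixing its four entries. [folklore] -/
private theorem variableChange_map_eq_of_apply_eq {R : Type*} [CommRing R] (C : VariableChange R)
    (f : R →+* R) (hu : f (C.u : R) = C.u) (hr : f C.r = C.r) (hs : f C.s = C.s)
    (ht : f C.t = C.t) : C.map f = C := by
  rcases C with ⟨u₀, r₀, s₀, t₀⟩
  simp only [VariableChange.map, VariableChange.mk.injEq]
  exact ⟨Units.ext hu, hr, hs, ht⟩

/-- **A relatively open neighbourhood of `1` in `G ≤ Γ_{K_v}` contains `G ∩ Gal(K̄_v/L₀)` for a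
finite normal `L₀/K_v`** (Krull topology, `krullTopology_mem_nhds_one_iff_of_normal`). [folklore] -/
private theorem exists_normal_fixingSubgroup_subset (G : Subgroup (absoluteGaloisGroup (v.adicCompletion K)))
    {Z : Set G} (hZ : IsOpen Z) (h1 : (1 : G) ∈ Z) :
    ∃ L₀ : IntermediateField (v.adicCompletion K) (AlgebraicClosure (v.adicCompletion K)),
      FiniteDimensional (v.adicCompletion K) L₀ ∧ Normal (v.adicCompletion K) L₀ ∧
      ∀ u : G, absoluteGaloisGroup.toAlgEquiv (v.adicCompletion K) (u : absoluteGaloisGroup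
        (v.adicCompletion K)) ∈ L₀.fixingSubgroup → u ∈ Z := by
  haveI := isGalois_algebraicClosure_adicCompletion (v := v)
  obtain ⟨t, htopen, ht⟩ := isOpen_induced_iff.mp hZ
  have h1t : (1 : absoluteGaloisGroup (v.adicCompletion K)) ∈ t := by
    have : (1 : G) ∈ Subtype.val ⁻¹' t := by rw [ht]; exact h1
    exact this
  obtain ⟨L₀, hL₀fin, hL₀normal, hL₀sub⟩ :=
    (krullTopology_mem_nhds_one_iff_of_normal (v.adicCompletion K)
      (AlgebraicClosure (v.adicCompletion K)) t).mp (htopen.mem_nhds h1t)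
  refine ⟨L₀, hL₀fin, hL₀normal, fun u hu ↦ ?_⟩
  have h2 : u ∈ Subtype.val ⁻¹' t := hL₀sub hu
  rw [ht] at h2
  exact h2

end Galois

end Literature.NumberTheory.EllipticCurves.CoatesGreenberg1996.GoodModelLine.KernelH1

end Part1

/-!
## Part 2 — port of `Summits/BirchSwinnertonDyer/Rank1Residual/Additive/GoodModelKernelH1Transport.lean`

# The good-model transport `Φ_C` of the Coates–Greenberg record: coordinate action of the
# `C`-fixing Galois elements, Hensel lifts of the parameter over `K̄_v`, completeness of the
# finite layers (inputs of the almost-étale engine `GoodModelFormalH1AlmostEtale`)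

HONEST FRAMING (BSD rank-`≤ 1` residual cell `b2b-bsdres`, home
`run/shared/lean/b2b/bsd-rank1-residual/`, team n1011, seat n1011-p05 GEN 9, row T-CG-DR, skeleton
`cells/n1011/skel/T-CG-DR.md`): the cell deletes the COMBINATION-SHAPED residual classes of the
rank-`≤ 1` BSD formula from PUBLISHED theorems only and TYPES the construction-shaped ones;
research route, no claim beyond the stated classes, census output = EVIDENCE, nothing booked, no
mark moves. TOOL file (theorems only, no definition, no named fact): the three local inputs with
which the END `GoodModelKernelH1OfDeeplyRamified` feeds the abstract engine
`AlmostEtale.exists_forall_eq_sub_of_cocycle_of_trace` in order to DERIVE the record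
`CoatesGreenberg1996.H1_goodModelKernel_trivial` (A254) from the trace form of "deeply ramified".

## Contents

* §1 `exists_mem_kernel_zCoord_eq_of_isAlgClosed` — over an ALGEBRAICALLY CLOSED valued field
  `(L, w)` every `a` with `|a| < 1` is the parameter `z = -x/y` of a point of the kernel of
  reduction `E₁` of a `w`-integral elliptic Weierstrass equation `V/L` (Silverman VII.2.2; Hensel in
  the henselian ring `𝒪_w`, `henselianLocalRing_integer`; transcription of the tree's
  `exists_mem_kernel_zCoord_eq` of `UnramifiedCoboundaryInputs` — which is stated for a base change
  from `K_v` — to an arbitrary integral `V`, needed because the good model `W₀ ⊗ K̄_v` is NOT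
  defined over `K_v`); `eq_of_mem_kernel_of_zCoord_eq` — `z` is injective on `E₁`.
* §2 `exists_limit_of_finiteDimensional` — a finite layer `Kn ⊆ K̄_v` over `K_v` is complete for
  the spectral valuation: sequences with `|x_{r+1} - x_r| ≤ θ^{r+1}` (`θ < 1`) converge in `Kn`
  (`spectralNorm.completeSpace`; the tree's `exists_limit_of_mem_adjoin` for `K_v(ζ)` verbatim,
  with `K_v(ζ)` replaced by any finite-dimensional intermediate field).
* §3 The transport `Φ_C P = congrEquiv hW₀ (pointEquiv _ C (congrEquiv _ P))` of the record
  (`E(K̄_v) → W₀(K̄_v)`, `W₀ ⊗ K̄_v = C • E ⊗ K̄_v`): for `σ ∈ Γ_{K_v}` FIXING `C`,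
  `Φ_C(σ • P)` is `σ` applied to the coordinates of `Φ_C(P)` (`transport_smul_of_eq_some`,
  `transport_smul_eq_zero_iff`); the substitution formulas `σ (C.toX x) = C.toX (σ x)`,
  `σ (C.toY x y) = C.toY (σ x) (σ y)`.

References: J. H. Silverman, *AEC* 2nd ed. III.1 (Table 3.1), IV.1, VII.2.1–2.2
[SilvermanAEC2009]; J. Neukirch, *ANT* II (4.6), (6.x) (Hensel; henselian valued fields)
[NeukirchANT1999]; tree: `FormalGroupChart` (`approxRoot`, `monic_cubic_eval`, `equation_of_root`,
`one_lt_val_of_root`, `eq_of_z_eq`), `ReductionInertiaInvarianceProofs`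
(`henselianLocalRing_integer`), `UnramifiedLayerRootsProofs` (`exists_limit_of_mem_adjoin`),
`SelmerFiniteProofs` (`congrEquiv_smul`), `VariableChangePoints` (`pointEquiv_some`, `toX_def`,
`toY_def`).
-/

section Part2


open scoped Classical NNReal

open WeierstrassCurve Polynomial

universe u

namespace Literature.NumberTheory.EllipticCurves.CoatesGreenberg1996.GoodModelLine.KernelH1

open Literature.NumberTheory.EllipticCurves Literature.NumberTheory.EllipticCurves.FormalGroupChart

/-! ## §1 Points of `E₁` with prescribed parameter over an algebraically closed valued field -/

section Hensel

variable {L : Type u} [Field L] {w : Valuation L ℝ≥0} {V : WeierstrassCurve L}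
  [hV : V.IsIntegral w.integer]

/-- **`z` is injective on `E₁`**: two points of the kernel of reduction with the same parameter
coincide (`|z(P - Q)| = |z P - z Q|` and `z = 0` only at `O` on `E₁`). [folklore] -/
private theorem eq_of_mem_kernel_of_zCoord_eq {P Q : V.toAffine.Point} (hP : P ∈ kernel w V)
    (hQ : Q ∈ kernel w V) (h : P.zCoord = Q.zCoord) : P = Q := by
  have h1 : w (P - Q).zCoord = 0 := by rw [← val_zCoord_sub hP hQ, h, sub_self, map_zero]
  have h2 : (P - Q).zCoord = 0 := (Valuation.zero_iff w).mp h1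
  exact sub_eq_zero.mp ((zCoord_eq_zero_iff ((kernel w V).sub_mem hP hQ)).mp h2)

variable [IsAlgClosed L] [V.IsElliptic]

/-- **`z : E₁(L) → 𝔪_L` is onto for `L` algebraically closed** (Silverman, *AEC* Prop. VII.2.2,
surjectivity half of `E₁ ≅ Ê(𝔪)`): every `a ∈ L` with `|a| < 1` is the parameter of a point
`P = (-a y, y) ∈ E₁(L)` of the `w`-integral elliptic equation `V`, where `Y = a³ y` is the Hensel
root `≡ -(1 - a₁a - a₂a²)` of the monic cubic `Y³ + (1 - a₁a - a₂a²)Y² + (a₃ + a₄a)a³Y - a₆a⁶`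
(`approxRoot`, `monic_cubic_eval`, `equation_of_root`, `one_lt_val_of_root`; `𝒪_w` is henselian,
`henselianLocalRing_integer`). Transcription of the tree's `exists_mem_kernel_zCoord_eq` (stated for
a base change from `K_v`) to an arbitrary integral `V/L`.
[cite: SilvermanAEC2009, Prop. VII.2.2 (PDF p. 191) and IV.1] -/
theorem exists_mem_kernel_zCoord_eq_of_isAlgClosed {a : L} (ha : w a < 1) :
    ∃ P ∈ kernel w V, P.zCoord = a := by
  by_cases ha0 : a = 0
  · exact ⟨0, (kernel w V).zero_mem, by rw [WeierstrassCurve.Affine.Point.zCoord_zero, ha0]⟩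
  have ha0' : 0 < w a := (Valuation.pos_iff w).mpr ha0
  have hvw : w.Integers w.integer := Valuation.integer.integers w
  haveI := henselianLocalRing_integer w
  have ha1 : w a ≤ 1 := ha.le
  have ha₃ : w V.a₃ ≤ 1 := val_a₃_le_one
  have ha₄ : w V.a₄ ≤ 1 := val_a₄_le_one
  have ha₆ : w V.a₆ ≤ 1 := val_a₆_le_one
  -- the coefficients of the monic cubic
  set u : L := 1 - V.a₁ * a - V.a₂ * a ^ 2 with hu
  set c : L := (V.a₃ + V.a₄ * a) * a ^ 3 with hc
  set d : L := V.a₆ * a ^ 6 with hd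
  obtain ⟨hu1, happ, huniq⟩ := approxRoot (V := V) (w := w) ha
  have hu_le : w u ≤ 1 := hu1.le
  have hca : w c ≤ w a ^ 3 := by
    rw [hc, map_mul, map_pow]
    refine mul_le_of_le_one_left zero_le ?_
    refine (Valuation.map_add w _ _).trans (max_le ha₃ ?_)
    rw [map_mul]; exact mul_le_one' ha₄ ha1
  have ha3lt : w a ^ 3 < 1 := pow_lt_one₀ zero_le ha three_ne_zero
  have hc1 : w c ≤ 1 := hca.trans ha3lt.le
  have hd1 : w d ≤ 1 := by
    rw [hd, map_mul, map_pow]; exact mul_le_one' ha₆ (pow_le_one₀ zero_le ha1)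
  -- integral lifts
  set uR : w.integer := ⟨u, hu_le⟩ with huR
  set cR : w.integer := ⟨c, hc1⟩ with hcR
  set dR : w.integer := ⟨d, hd1⟩ with hdR
  have huRc : ((uR : w.integer) : L) = u := rfl
  have hcRc : ((cR : w.integer) : L) = c := rfl
  have hdRc : ((dR : w.integer) : L) = d := rfl
  -- the monic cubic over `𝒪_w` and its approximate root `-u`
  set f : (w.integer)[X] :=
    Polynomial.X ^ 3 + C uR * Polynomial.X ^ 2 + C cR * Polynomial.X - C dR with hf
  have hfmonic : f.Monic := by
    rw [hf, sub_eq_add_neg, add_assoc, add_assoc]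
    refine (monic_X_pow 3).add_of_left ?_
    refine (degree_add_le _ _).trans_lt (max_lt ?_ ((degree_add_le _ _).trans_lt (max_lt ?_ ?_)))
    · exact (degree_C_mul_X_pow_le 2 _).trans_lt (by rw [degree_X_pow]; norm_num)
    · exact (degree_C_mul_X_le _).trans_lt (by rw [degree_X_pow]; norm_num)
    · rw [degree_neg]; exact (degree_C_le).trans_lt (by rw [degree_X_pow]; norm_num)
  have hfeval : ∀ Y : w.integer, ((f.eval Y : w.integer) : L) =
      (Y : L) ^ 3 + u * (Y : L) ^ 2 + c * (Y : L) - d := by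
    intro Y
    change algebraMap w.integer L (f.eval Y) = _
    rw [hf]
    simp only [eval_add, eval_sub, eval_mul, eval_pow, eval_X, eval_C, map_add, map_sub, map_mul,
      map_pow]
    rfl
  have hfder : ∀ Y : w.integer, ((f.derivative.eval Y : w.integer) : L) =
      3 * (Y : L) ^ 2 + 2 * u * (Y : L) + c := by
    intro Y
    change algebraMap w.integer L (f.derivative.eval Y) = _
    have : f.derivative = 3 * Polynomial.X ^ 2 + 2 * C uR * Polynomial.X + C cR := by
      rw [hf]
      simp only [derivative_add, derivative_sub, derivative_X_pow, derivative_mul, derivative_C,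
        derivative_X, zero_mul, zero_add, mul_one, sub_zero, Nat.cast_ofNat, map_ofNat]
      ring
    rw [this]
    simp only [eval_add, eval_mul, eval_pow, eval_X, eval_C, eval_ofNat, map_add, map_mul, map_pow,
      map_ofNat]
    rfl
  set b₁ : w.integer := ⟨-u, by change w (-u) ≤ 1; rw [Valuation.map_neg]; exact hu_le⟩ with hb₁
  have hb₁c : ((b₁ : w.integer) : L) = -u := rfl
  have h₁ : f.eval b₁ ∈ IsLocalRing.maximalIdeal w.integer := by
    rw [← IsLocalRing.residue_eq_zero_iff, ← v_algebraMap_lt_one_iff hvw]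
    change w ((f.eval b₁ : w.integer) : L) < 1
    rw [hfeval, hb₁c]
    refine lt_of_le_of_lt (le_trans (le_of_eq ?_) happ) ha3lt
    rw [hu, hc, hd]
  have h₂ : IsUnit (f.derivative.eval b₁) := by
    rw [hvw.isUnit_iff_valuation_eq_one]
    change w ((f.derivative.eval b₁ : w.integer) : L) = 1
    rw [hfder, hb₁c, show (3 : L) * (-u) ^ 2 + 2 * u * -u + c = u ^ 2 + c by ring,
      Valuation.map_add_eq_of_lt_left]
    · rw [map_pow, hu1, one_pow]
    · rw [map_pow, hu1, one_pow]; exact hca.trans_lt ha3lt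
  obtain ⟨Y₀, hY₀root, hY₀cong⟩ := HenselianLocalRing.is_henselian f hfmonic b₁ h₁ h₂
  -- `|Y₀| = 1`
  have hY₀1 : w (Y₀ : L) = 1 := by
    refine huniq _ ?_
    have := hY₀cong
    rw [← IsLocalRing.residue_eq_zero_iff, ← v_algebraMap_lt_one_iff hvw] at this
    change w ((Y₀ : L) - (b₁ : L)) < 1 at this
    rwa [hb₁c, sub_neg_eq_add] at this
  -- the point
  have ha3 : a ^ 3 ≠ 0 := pow_ne_zero 3 ha0
  set y : L := (Y₀ : L) / a ^ 3 with hy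
  have hYy : (Y₀ : L) = y * a ^ 3 := by rw [hy, div_mul_cancel₀ _ ha3]
  have hrootL : (Y₀ : L) ^ 3 + u * (Y₀ : L) ^ 2 + c * (Y₀ : L) - d = 0 := by
    have h := congrArg (fun z : w.integer ↦ (z : L)) (show f.eval Y₀ = 0 from hY₀root)
    simp only [hfeval] at h
    simpa using h
  have hg : a ^ 3 * y ^ 3 + (1 - V.a₁ * a - V.a₂ * a ^ 2) * y ^ 2 + (V.a₃ + V.a₄ * a) * y - V.a₆
      = 0 := by
    have hm := monic_cubic_eval (V := V) a y
    rw [← hYy] at hm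
    have h6 : a ^ 6 * (a ^ 3 * y ^ 3 + (1 - V.a₁ * a - V.a₂ * a ^ 2) * y ^ 2 +
        (V.a₃ + V.a₄ * a) * y - V.a₆) = 0 := by
      rw [← hm, ← hrootL, hu, hc, hd]
    exact (mul_eq_zero.mp h6).resolve_left (pow_ne_zero 6 ha0)
  have heq : V.toAffine.Equation (-a * y) y := equation_of_root hg
  have hns : V.toAffine.Nonsingular (-a * y) y := (Affine.equation_iff_nonsingular).mp heq
  have hwy : w y * w a ^ 3 = 1 := by rw [← map_pow, ← map_mul, ← hYy, hY₀1]
  have hy0 : y ≠ 0 := by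
    intro h; rw [h, map_zero, zero_mul] at hwy; exact zero_ne_one hwy
  refine ⟨.some _ _ hns, some_mem_kernel hns (one_lt_val_of_root ha0' ha hwy), ?_⟩
  rw [WeierstrassCurve.Affine.Point.zCoord_some]
  field_simp

end Hensel

/-! ## §2 Completeness of a finite layer `Kn ⊆ K̄_v` for the spectral valuation -/

section Complete

open NumberField IsDedekindDomain

variable {K : Type u} [Field K] [NumberField K] {v : HeightOneSpectrum (𝓞 K)}
  {w : Valuation (AlgebraicClosure (v.adicCompletion K)) ℝ≥0}
  (hw : ∀ x, (w x : ℝ) =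
    spectralNorm (v.adicCompletion K) (AlgebraicClosure (v.adicCompletion K)) x)

include hw in
/-- **Completeness of a finite layer** `Kn ⊆ K̄_v` (`Kn/K_v` finite-dimensional) for the spectral
valuation: a sequence `(x_r)` in `Kn` with `|x_{r+1} - x_r|_v ≤ θ^{r+1}`, `θ < 1`, converges to
some `y ∈ Kn` with `|y - x_r|_v ≤ θ^{r+1}` (`Kn` is complete for the spectral norm, Mathlib
`spectralNorm.completeSpace`; the bound by the ultrametric inequality). The tree's
`exists_limit_of_mem_adjoin` (for `K_v(ζ)`), with the layer generalised. [folklore] -/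
private theorem exists_limit_of_finiteDimensional
    (Kn : IntermediateField (v.adicCompletion K) (AlgebraicClosure (v.adicCompletion K)))
    [FiniteDimensional (v.adicCompletion K) Kn] {ρ : ℝ≥0} (hρ1 : ρ < 1) (x : ℕ → Kn)
    (hx : ∀ r, w ((x (r + 1) : AlgebraicClosure (v.adicCompletion K)) - x r) ≤ ρ ^ (r + 1)) :
    ∃ y : Kn, ∀ r, w ((y : AlgebraicClosure (v.adicCompletion K)) - x r) ≤ ρ ^ (r + 1) := by
  letI : NontriviallyNormedField (v.adicCompletion K) :=
    Valued.toNontriviallyNormedField (v.adicCompletion K) (WithZero (Multiplicative ℤ))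
  letI : NormedField Kn := spectralNorm.normedField (v.adicCompletion K) Kn
  haveI : CompleteSpace Kn := spectralNorm.completeSpace (v.adicCompletion K) Kn
  -- the norm on `Kn` is the spectral valuation
  have hnorm : ∀ z : Kn, ‖z‖ = (w (z : AlgebraicClosure (v.adicCompletion K)) : ℝ) := fun z ↦ by
    change spectralNorm (v.adicCompletion K) Kn z = _
    rw [hw, spectralNorm.eq_of_tower (L := AlgebraicClosure (v.adicCompletion K))]
    rfl
  -- the ultrametric estimate `|x_{r+k} - x_r| ≤ ρ^{r+1}`
  have hultra : ∀ r k, w ((x (r + k) : AlgebraicClosure (v.adicCompletion K)) - x r) ≤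
      ρ ^ (r + 1) := by
    intro r k
    induction k with
    | zero => rw [add_zero, sub_self, map_zero]; exact zero_le
    | succ k ih =>
      have e : (x (r + (k + 1)) : AlgebraicClosure (v.adicCompletion K)) - x r =
          ((x (r + k + 1) : AlgebraicClosure (v.adicCompletion K)) - x (r + k)) +
            ((x (r + k) : AlgebraicClosure (v.adicCompletion K)) - x r) := by
        rw [← add_assoc]; ring
      rw [e]
      refine (Valuation.map_add w _ _).trans (max_le ((hx (r + k)).trans ?_) ih)
      exact pow_le_pow_right_of_le_one' hρ1.le (by omega)
  -- Cauchy, hence convergent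
  have hcauchy : CauchySeq x := by
    refine cauchySeq_of_le_geometric (ρ : ℝ) (ρ : ℝ) (by exact_mod_cast hρ1) fun r ↦ ?_
    rw [dist_eq_norm, ← norm_neg, neg_sub, hnorm]
    push_cast
    rw [← pow_succ']
    exact_mod_cast hx r
  obtain ⟨y, hy⟩ := cauchySeq_tendsto_of_complete hcauchy
  refine ⟨y, fun r ↦ ?_⟩
  -- pass to the limit in `|x_{r+k} - x_r| ≤ ρ^{r+1}`
  have hshift : Filter.Tendsto (fun k ↦ x (k + r)) Filter.atTop (nhds y) :=
    hy.comp (Filter.tendsto_add_atTop_nat r)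
  have hlim : Filter.Tendsto (fun k ↦ ‖x (k + r) - x r‖) Filter.atTop (nhds ‖y - x r‖) :=
    (hshift.sub_const (x r)).norm
  have hle : ‖y - x r‖ ≤ (ρ : ℝ) ^ (r + 1) := by
    refine le_of_tendsto hlim (Filter.Eventually.of_forall fun k ↦ ?_)
    rw [hnorm, add_comm k r]
    push_cast
    exact_mod_cast hultra r k
  rw [hnorm] at hle
  push_cast at hle
  exact_mod_cast hle

end Complete

/-! ## §3 The transport `Φ_C` and the Galois elements fixing `C` -/

section Transport

open NumberField IsDedekindDomain Field Literature.NumberTheory.GaloisRepresentations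

variable {K : Type u} [Field K] [NumberField K] (W : WeierstrassCurve K)
  (v : HeightOneSpectrum (𝓞 K)) {w : Valuation (AlgebraicClosure (v.adicCompletion K)) ℝ≥0}
  (C : VariableChange (AlgebraicClosure (v.adicCompletion K)))
  {W₀ : WeierstrassCurve w.integer}
  (hW₀ : C • (W.baseChange (v.adicCompletion K)).baseChange (AlgebraicClosure (v.adicCompletion K)) =
    W₀.baseChange (AlgebraicClosure (v.adicCompletion K)))

/-- The substitution `x ↦ u⁻²(x - r)` commutes with a ring endomorphism fixing `C`.
[cite: SilvermanAEC2009, III.1 Table 3.1] -/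
theorem apply_toX_of_map_eq {R : Type*} [CommRing R] (D : VariableChange R) (f : R →+* R)
    (hf : D.map f = D) (x : R) : f (D.toX x) = D.toX (f x) := by
  have hu : f (↑D.u⁻¹ : R) = ↑D.u⁻¹ := by
    have h := congrArg (fun D' : VariableChange R ↦ ((D'.u⁻¹ : Rˣ) : R)) hf
    simp only [VariableChange.map, Units.coe_map_inv, MonoidHom.coe_coe] at h
    exact h
  have hr : f D.r = D.r := by
    have h := congrArg VariableChange.r hf
    simpa only [VariableChange.map] using h
  rw [VariableChange.toX_def, VariableChange.toX_def, map_mul, map_pow, map_sub, hu, hr]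

/-- The substitution `y ↦ u⁻³(y - s(x - r) - t)` commutes with a ring endomorphism fixing `C`.
[cite: SilvermanAEC2009, III.1 Table 3.1] -/
theorem apply_toY_of_map_eq {R : Type*} [CommRing R] (D : VariableChange R) (f : R →+* R)
    (hf : D.map f = D) (x y : R) : f (D.toY x y) = D.toY (f x) (f y) := by
  have hu : f (↑D.u⁻¹ : R) = ↑D.u⁻¹ := by
    have h := congrArg (fun D' : VariableChange R ↦ ((D'.u⁻¹ : Rˣ) : R)) hf
    simp only [VariableChange.map, Units.coe_map_inv, MonoidHom.coe_coe] at h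
    exact h
  have hr : f D.r = D.r := by
    have h := congrArg VariableChange.r hf
    simpa only [VariableChange.map] using h
  have hs : f D.s = D.s := by
    have h := congrArg VariableChange.s hf
    simpa only [VariableChange.map] using h
  have ht : f D.t = D.t := by
    have h := congrArg VariableChange.t hf
    simpa only [VariableChange.map] using h
  rw [VariableChange.toY_def, VariableChange.toY_def, map_mul, map_pow, map_sub, map_sub, map_mul,
    map_sub, hu, hr, hs, ht]

/-- **The transport `Φ_C` on affine points.** For `Q = (x₁, y₁)` on `(E ⊗ K_v) ⊗ K̄_v`,
`congrEquiv hW₀ (pointEquiv _ C Q) = (C.toX x₁, C.toY x₁ y₁)` on the good model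
`W₀ ⊗ K̄_v = C • E ⊗ K̄_v`. [cite: SilvermanAEC2009, III.1 Table 3.1] -/
theorem transport_some {x₁ y₁ : AlgebraicClosure (v.adicCompletion K)}
    (h₁ : ((W.baseChange (v.adicCompletion K)).baseChange
      (AlgebraicClosure (v.adicCompletion K))).toAffine.Nonsingular x₁ y₁) :
    ∃ h', Affine.Point.congrEquiv hW₀ (VariableChange.pointEquiv _ C (Affine.Point.some x₁ y₁ h₁)) =
      Affine.Point.some (C.toX x₁) (C.toY x₁ y₁) h' :=
  ⟨_, by rw [VariableChange.pointEquiv_some, Affine.Point.congrEquiv_some]⟩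

/-- **`Φ_C` intertwines `σ` with the coordinate action, for `σ` fixing `C`.** If
`Φ_C(P) = (x, y)` then `Φ_C(σ • P) = (σ x, σ y)` (`σ ∈ Γ_{K_v}` with `C.map σ = C`;
`Φ_C P = congrEquiv hW₀ (pointEquiv _ C (congrEquiv _ P))` the transport of the record): `Φ_C(P)`
has coordinates `(C.toX x₁, C.toY x₁ y₁)` for `P = (x₁, y₁)`, `σ • P = (σ x₁, σ y₁)`
(`congrEquiv_smul`), and `σ` commutes with the substitution (`apply_toX_of_map_eq`,
`apply_toY_of_map_eq`). [cite: SilvermanAEC2009, III.1 Table 3.1 and VIII.1] -/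
theorem transport_smul_of_eq_some (σ : absoluteGaloisGroup (v.adicCompletion K))
    (hσC : C.map ((absoluteGaloisGroup.toAlgEquiv (v.adicCompletion K) σ :
        AlgebraicClosure (v.adicCompletion K) ≃ₐ[v.adicCompletion K]
          AlgebraicClosure (v.adicCompletion K)) :
        AlgebraicClosure (v.adicCompletion K) →+* AlgebraicClosure (v.adicCompletion K)) = C)
    (P : localPoints W (v.adicCompletion K)) {x y : AlgebraicClosure (v.adicCompletion K)}
    {h : (W₀.baseChange (AlgebraicClosure (v.adicCompletion K))).toAffine.Nonsingular x y}
    (hP : Affine.Point.congrEquiv hW₀ (VariableChange.pointEquiv _ C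
        (Affine.Point.congrEquiv (baseChange_baseChange_adicCompletion W v).symm P)) =
      Affine.Point.some x y h) :
    ∃ h', Affine.Point.congrEquiv hW₀ (VariableChange.pointEquiv _ C
        (Affine.Point.congrEquiv (baseChange_baseChange_adicCompletion W v).symm (σ • P))) =
      Affine.Point.some (absoluteGaloisGroup.toAlgEquiv (v.adicCompletion K) σ x)
        (absoluteGaloisGroup.toAlgEquiv (v.adicCompletion K) σ y) h' := by
  set σ' : AlgebraicClosure (v.adicCompletion K) →+* AlgebraicClosure (v.adicCompletion K) :=
    ((absoluteGaloisGroup.toAlgEquiv (v.adicCompletion K) σ :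
        AlgebraicClosure (v.adicCompletion K) ≃ₐ[v.adicCompletion K]
          AlgebraicClosure (v.adicCompletion K)) :
        AlgebraicClosure (v.adicCompletion K) →+* AlgebraicClosure (v.adicCompletion K)) with hσ'
  rw [congrEquiv_smul]
  generalize hQ : Affine.Point.congrEquiv (baseChange_baseChange_adicCompletion W v).symm P = Q
  rw [hQ] at hP
  rcases Q with _ | ⟨x₁, y₁, h₁⟩
  · -- `Q = O`: then `Φ P = O ≠ some`
    exfalso
    rw [← WeierstrassCurve.Affine.Point.zero_def, map_zero, map_zero] at hP
    exact WeierstrassCurve.Affine.Point.some_ne_zero _ hP.symm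
  · obtain ⟨h₁', e₁⟩ := transport_some W v C hW₀ h₁
    rw [e₁] at hP
    simp only [WeierstrassCurve.Affine.Point.some.injEq] at hP
    obtain ⟨rfl, rfl⟩ := hP
    obtain ⟨h₂, hmap⟩ : ∃ h₂, Affine.Point.map
        ((absoluteGaloisGroup.toAlgEquiv (v.adicCompletion K) σ :
          AlgebraicClosure (v.adicCompletion K) ≃ₐ[v.adicCompletion K]
            AlgebraicClosure (v.adicCompletion K)) :
          AlgebraicClosure (v.adicCompletion K) →ₐ[v.adicCompletion K]
            AlgebraicClosure (v.adicCompletion K)) (Affine.Point.some x₁ y₁ h₁) =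
        Affine.Point.some (σ' x₁) (σ' y₁) h₂ :=
      ⟨_, by rw [Affine.Point.map_some]; rfl⟩
    rw [hmap]
    obtain ⟨h₃, e₃⟩ := transport_some W v C hW₀ h₂
    rw [e₃]
    have ex : C.toX (σ' x₁) = σ' (C.toX x₁) := (apply_toX_of_map_eq C σ' hσC x₁).symm
    have ey : C.toY (σ' x₁) (σ' y₁) = σ' (C.toY x₁ y₁) := (apply_toY_of_map_eq C σ' hσC x₁ y₁).symm
    exact ⟨ex ▸ ey ▸ h₃, point_some_eq_some ex ey⟩

/-- `Φ_C` is a bijection fixing `O`, so `Φ_C(σ • P) = O` iff `Φ_C(P) = O`. [folklore] -/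
private theorem transport_smul_eq_zero_iff (σ : absoluteGaloisGroup (v.adicCompletion K))
    (P : localPoints W (v.adicCompletion K)) :
    Affine.Point.congrEquiv hW₀ (VariableChange.pointEquiv _ C
        (Affine.Point.congrEquiv (baseChange_baseChange_adicCompletion W v).symm (σ • P))) = 0 ↔
      Affine.Point.congrEquiv hW₀ (VariableChange.pointEquiv _ C
        (Affine.Point.congrEquiv (baseChange_baseChange_adicCompletion W v).symm P)) = 0 := by
  simp only [AddEquiv.map_eq_zero_iff]
  change σ • P = (0 : localPoints W (v.adicCompletion K)) ↔ P = (0 : localPoints W (v.adicCompletion K))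
  exact smul_eq_zero_iff_eq σ

end Transport

end Literature.NumberTheory.EllipticCurves.CoatesGreenberg1996.GoodModelLine.KernelH1

end Part2

/-!
## Part 3 — port of `Summits/BirchSwinnertonDyer/Rank1Residual/Additive/GoodModelKernelH1OfDeeplyRamified.lean`

# The Coates–Greenberg record `H1_goodModelKernel_trivial` (A254: `H¹(L, Ŵ₀(𝔪̄)) = 0` for a good
# model, [CoGr] Cor. 3.2 in cocycle form) DERIVED from the trace form of "deeply ramified"
# (`CoatesGreenberg1996.deeplyRamified_cyclotomic_trace`) by the almost-étale successive
# approximation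

HONEST FRAMING (BSD rank-`≤ 1` residual cell `b2b-bsdres`, home
`run/shared/lean/b2b/bsd-rank1-residual/`, team n1011, seat n1011-p05 GEN 9, row T-CG-DR, skeleton
`cells/n1011/skel/T-CG-DR.md`, lead R5-83 (e), referee-1 GEN 32 ACK-1): the cell deletes the
COMBINATION-SHAPED residual classes of the rank-`≤ 1` BSD formula from PUBLISHED theorems only and
TYPES the construction-shaped ones; research route, no claim beyond the stated classes, census
output = EVIDENCE, nothing booked, no mark moves. END file (theorems only, no definition, no named
fact): `CoatesGreenberg1996.H1_goodModelKernel_trivial_of_deeplyRamifiedTrace : DR → R` with R's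
signature UNCHANGED — registry A254 becomes DERIVED modulo the field-theoretic fact DR; NOT a
discharge of Tate–Sen / [CoGr] §2. Consumers may switch `hCG ↦ …_of_deeplyRamifiedTrace hDR`.

## Proof (assembly of `AlmostEtale.exists_forall_eq_sub_of_cocycle_of_trace`)

(1) `V = W₀ ⊗ K̄_v` is `w`-integral and elliptic; `T_g = Φ_C ∘ g ∘ Φ_C⁻¹` acts on coordinates
through `g` for every `g` FIXING `C` (`KernelH1.transport_smul_of_eq_some`), so it preserves
`E₁ = FormalGroupChart.kernel w V = Ŵ₀(𝔪̄)` with `z(T_g P) = g (z P)`. (2) `φ` vanishes on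
`U = G ∩ Gal(K̄_v/M₁)` for a finite normal `M₁ ⊇` (a Krull neighbourhood field, the entries of `C`,
the coordinates of the finitely many values `Φ_C(φ g)`); `G/U` is finite. (3) `|z Φ_C(φ g)| ≤ ρ₀ < 1`;
the FACT at `(G, Gal(K̄_v/M₁), √ρ₀)` gives an integral `U`-fixed `x` with
`η = |Σ_{q ∈ G/U} q.out • x| > √ρ₀`, so `ρ₀ = η² θ`, `θ < 1`. (4) The layer `Kn = M₁ ⊔ K_v(G • x)` is
finite over `K_v` (complete), `G`-stable and fixed by `U` (`GoodModelKernelH1Layer`);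
`Rat = {P | T_u P = P ∀ u ∈ Gal(K̄_v/Kn)}` = `O` and the points with coordinates in `Kn`; Hensel
lifts `KernelH1.exists_mem_kernel_zCoord_eq_of_isAlgClosed` are rational by injectivity of `z` on
`E₁`. (5) The engine gives `P ∈ E₁ ∩ Rat` with `Φ_C(φ g) = T_g P − P`, i.e. `φ g = g • a − a`,
`a = Φ_C⁻¹ P`.

References: [CoatesGreenberg1996] §2 p. 143, Thm. 2.13, §3 Thm. 3.1 / Cor. 3.2;
[IovitaZaharescu1999] Thm. 1.2; [GreenbergLNM1716] Greenberg pp. 83–84, Coates pp. 27, 36–37;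
[Bondarko2007FormalGroupsSurvey] Thm. 9.2; [SilvermanAEC2009] VII.2.1–2.2; tree: the siblings
named above, `PeriodIndexSupportProofs` (pattern of the Milne I.3.8 discharge).
-/

section Part3


open scoped Classical NNReal

open WeierstrassCurve NumberField IsDedekindDomain Field
  Literature.NumberTheory.GaloisRepresentations Literature.NumberTheory.EllipticCurves
  Literature.NumberTheory.EllipticCurves.FormalGroupChart IsDedekindDomain.HeightOneSpectrum

universe u

namespace Literature.NumberTheory.EllipticCurves.CoatesGreenberg1996.GoodModelLine.KernelH1

/-! ## The derivation -/

section Main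

open CoatesGreenberg1996

variable {K : Type u} [Field K] [NumberField K] {v : HeightOneSpectrum (𝓞 K)}

set_option maxHeartbeats 1600000 in
/-- **The Coates–Greenberg vanishing for a good model, from the trace form of "deeply ramified"**
(all binders of the record `H1_goodModelKernel_trivial` explicit; the record itself is the next
theorem): for `E/K` elliptic over a number field, `p`, `κ` cyclotomic, `v ∋ p`, the spectral `w`, a
good model `W₀ = C • E ⊗ K̄_v`, a CLOSED `G ≤ (ker κ)_v` fixing `C`, every continuous crossed
homomorphism `φ : G → E(K̄_v)` with `Φ_C(φ g) ∈ Ŵ₀(𝔪̄)` is `g ↦ g • a − a` with `Φ_C(a) ∈ Ŵ₀(𝔪̄)` —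
[CoGr] Cor. 3.2 (`H¹(L, 𝓕(𝔪̄)) = 0`, `L = K̄_v^G` deeply ramified) by [CoGr]'s own mechanism
(Thm. 3.1 / Bondarko Thm. 9.2: `AlmostEtale.exists_forall_eq_sub_of_cocycle_of_trace`) from the trace
form of §2 p. 143 / Thm. 2.13 (`hDR`). Proof: module docstring. NOT a discharge of Tate–Sen.
[cite: CoatesGreenberg1996, §3 Cor. 3.2 with Thm. 3.1 (mechanism) and §2 p. 143 / Thm. 2.13 (input), through GreenbergLNM1716 pp. 27, 36–37, 83–84 and IovitaZaharescu1999 Thm. 1.2]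
[cite: Bondarko2007FormalGroupsSurvey, §9.2 Thm. 9.2] -/
theorem exists_eq_smul_sub_of_deeplyRamifiedTrace (hDR : deeplyRamified_cyclotomic_trace.{u})
    (W : WeierstrassCurve K) [W.IsElliptic] (p : ℕ) [Fact p.Prime] (κ : ZpExtension K p)
    (hκ : κ.IsCyclotomic) (hpv : ((p : ℕ) : 𝓞 K) ∈ v.asIdeal) (w : Valuation (AlgebraicClosure (v.adicCompletion K)) ℝ≥0)
    (hw : ∀ x, (w x : ℝ) = spectralNorm (v.adicCompletion K) (AlgebraicClosure (v.adicCompletion K)) x) (C : VariableChange (AlgebraicClosure (v.adicCompletion K)))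
    (W₀ : WeierstrassCurve w.integer)
    (hW₀ : C • (W.baseChange (v.adicCompletion K)).baseChange (AlgebraicClosure (v.adicCompletion K)) = W₀.baseChange (AlgebraicClosure (v.adicCompletion K))) (hΔ : IsUnit W₀.Δ)
    (G : Subgroup (absoluteGaloisGroup (v.adicCompletion K))) (hGc : IsClosed (G : Set (absoluteGaloisGroup (v.adicCompletion K)))) (hGκ : G ≤ localSubgroup κ.kerSubgroup (v.adicCompletion K))
    (hGC : ∀ σ ∈ G, C.map ((absoluteGaloisGroup.toAlgEquiv (v.adicCompletion K) σ : (AlgebraicClosure (v.adicCompletion K)) ≃ₐ[(v.adicCompletion K)] (AlgebraicClosure (v.adicCompletion K))) : (AlgebraicClosure (v.adicCompletion K)) →+* (AlgebraicClosure (v.adicCompletion K))) = C)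
    (φ : contOneCocycles (discreteTopRep G (localPoints W (v.adicCompletion K))))
    (hφ : ∀ g, Affine.Point.congrEquiv hW₀ (VariableChange.pointEquiv _ C
      (Affine.Point.congrEquiv (baseChange_baseChange_adicCompletion W v).symm (φ.1 g))) ∈
        kernelOfReduction W₀ (Valuation.integer.integers w)) :
    ∃ a : localPoints W (v.adicCompletion K), Affine.Point.congrEquiv hW₀ (VariableChange.pointEquiv _ C
        (Affine.Point.congrEquiv (baseChange_baseChange_adicCompletion W v).symm a)) ∈
          kernelOfReduction W₀ (Valuation.integer.integers w) ∧
      ∀ g : G, φ.1 g = g • a - a := by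
  -- §A notation and basic structure
  haveI hGal := isGalois_algebraicClosure_adicCompletion (v := v)
  haveI : CharZero (v.adicCompletion K) := charZero_of_injective_algebraMap (algebraMap K (v.adicCompletion K)).injective
  haveI hVint : (W₀.baseChange (AlgebraicClosure (v.adicCompletion K))).IsIntegral w.integer := ⟨⟨W₀, rfl⟩⟩
  haveI hVell : (W₀.baseChange (AlgebraicClosure (v.adicCompletion K))).IsElliptic := by
    rw [isElliptic_iff, baseChange, map_Δ]
    exact hΔ.map _
  have hvw : w.Integers w.integer := Valuation.integer.integers w
  -- the transport `Φ` and the transported action `T`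
  set Φ : localPoints W (v.adicCompletion K) ≃+ (W₀.baseChange (AlgebraicClosure (v.adicCompletion K))).toAffine.Point :=
    ((Affine.Point.congrEquiv (baseChange_baseChange_adicCompletion W v).symm).trans
      (VariableChange.pointEquiv _ C)).trans (Affine.Point.congrEquiv hW₀) with hΦdef
  have hΦ : ∀ P, Φ P = Affine.Point.congrEquiv hW₀ (VariableChange.pointEquiv _ C
      (Affine.Point.congrEquiv (baseChange_baseChange_adicCompletion W v).symm P)) := fun _ ↦ rfl
  set T : (absoluteGaloisGroup (v.adicCompletion K)) → (W₀.baseChange (AlgebraicClosure (v.adicCompletion K))).toAffine.Point →+ (W₀.baseChange (AlgebraicClosure (v.adicCompletion K))).toAffine.Point :=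
    fun g ↦ Φ.toAddMonoidHom.comp
      ((DistribSMul.toAddMonoidHom (localPoints W (v.adicCompletion K)) g).comp Φ.symm.toAddMonoidHom) with hTdef
  have hT : ∀ g P, T g P = Φ (g • Φ.symm P) := fun _ _ ↦ rfl
  set σ : (absoluteGaloisGroup (v.adicCompletion K)) → ((AlgebraicClosure (v.adicCompletion K)) ≃+* (AlgebraicClosure (v.adicCompletion K))) := fun g ↦ ((absoluteGaloisGroup.toAlgEquiv (v.adicCompletion K) g : (AlgebraicClosure (v.adicCompletion K)) ≃ₐ[(v.adicCompletion K)] (AlgebraicClosure (v.adicCompletion K))).toRingEquiv) with hσdef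
  have hσ : ∀ g z, σ g z = g • z := fun _ _ ↦ rfl
  have hσw : ∀ g z, w (σ g z) = w z := fun g z ↦ spectralValuation_smul hw g z
  -- `T` on coordinates, for `g` fixing `C`
  have hTsome : ∀ g : (absoluteGaloisGroup (v.adicCompletion K)), C.map ((absoluteGaloisGroup.toAlgEquiv (v.adicCompletion K) g : (AlgebraicClosure (v.adicCompletion K)) ≃ₐ[(v.adicCompletion K)] (AlgebraicClosure (v.adicCompletion K))) : (AlgebraicClosure (v.adicCompletion K)) →+* (AlgebraicClosure (v.adicCompletion K))) = C →
      ∀ {x y : (AlgebraicClosure (v.adicCompletion K))} {h : (W₀.baseChange (AlgebraicClosure (v.adicCompletion K))).toAffine.Nonsingular x y},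
      ∃ h', T g (.some x y h) = .some (σ g x) (σ g y) h' := by
    intro g hgC x y h
    have hP : Affine.Point.congrEquiv hW₀ (VariableChange.pointEquiv _ C
        (Affine.Point.congrEquiv (baseChange_baseChange_adicCompletion W v).symm
          (Φ.symm (.some x y h)))) = .some x y h := by
      rw [← hΦ, AddEquiv.apply_symm_apply]
    obtain ⟨h', e⟩ := transport_smul_of_eq_some W v C hW₀ g hgC (Φ.symm (.some x y h)) hP
    exact ⟨h', by rw [hT, hΦ, e]; rfl⟩
  have hTC_ker : ∀ g, C.map ((absoluteGaloisGroup.toAlgEquiv (v.adicCompletion K) g : (AlgebraicClosure (v.adicCompletion K)) ≃ₐ[(v.adicCompletion K)] (AlgebraicClosure (v.adicCompletion K))) : (AlgebraicClosure (v.adicCompletion K)) →+* (AlgebraicClosure (v.adicCompletion K))) = C →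
      ∀ P, P ∈ kernel w (W₀.baseChange (AlgebraicClosure (v.adicCompletion K))) →
        T g P ∈ kernel w (W₀.baseChange (AlgebraicClosure (v.adicCompletion K))) ∧ (T g P).zCoord = σ g P.zCoord := by
    intro g hgC P hPK
    rcases P with _ | ⟨x, y, h⟩
    · rw [← WeierstrassCurve.Affine.Point.zero_def, map_zero, WeierstrassCurve.Affine.Point.zCoord_zero,
        map_zero]
      exact ⟨(kernel w _).zero_mem, rfl⟩
    · obtain ⟨h', e⟩ := hTsome g hgC (x := x) (y := y) (h := h)
      rw [e, WeierstrassCurve.Affine.Point.zCoord_some, WeierstrassCurve.Affine.Point.zCoord_some,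
        some_mem_kernel_iff, hσw, map_div₀, map_neg]
      exact ⟨(some_mem_kernel_iff h).mp hPK, rfl⟩
  have hGC' : ∀ g : G, C.map ((absoluteGaloisGroup.toAlgEquiv (v.adicCompletion K) (g : (absoluteGaloisGroup (v.adicCompletion K))) : (AlgebraicClosure (v.adicCompletion K)) ≃ₐ[(v.adicCompletion K)] (AlgebraicClosure (v.adicCompletion K))) : (AlgebraicClosure (v.adicCompletion K)) →+* (AlgebraicClosure (v.adicCompletion K))) = C := fun g ↦ hGC g g.2
  have hTmul : ∀ g h P, T (g * h) P = T g (T h P) := by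
    intro g h P
    rw [hT, hT, hT, AddEquiv.symm_apply_apply, mul_smul]
  -- §B the transported crossed homomorphism
  set c : G → (W₀.baseChange (AlgebraicClosure (v.adicCompletion K))).toAffine.Point := fun g ↦ Φ (φ.1 g) with hcdef
  have hc_apply : ∀ g, c g = Φ (φ.1 g) := fun _ ↦ rfl
  have hcK : ∀ g, c g ∈ kernel w (W₀.baseChange (AlgebraicClosure (v.adicCompletion K))) := by
    intro g
    rw [hc_apply, mem_kernel_iff_reducesToZero W₀, ← mem_kernelOfReduction_iff hvw, hΦ]
    exact hφ g
  have hcoc : ∀ g h : G, c (g * h) = c g + T (g : (absoluteGaloisGroup (v.adicCompletion K))) (c h) := by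
    intro g h
    rw [hc_apply, hc_apply, hc_apply, hT, AddEquiv.symm_apply_apply, φ.2 g h, map_add,
      discreteTopRep_ρ_apply]
    rfl
  -- §C the open zero set and the finite normal layer `M₁`
  obtain ⟨L₀, hL₀fin, hL₀normal, hL₀sub⟩ := exists_normal_fixingSubgroup_subset G
    ((isOpen_discrete ({0} : Set (localPoints W (v.adicCompletion K)))).preimage φ.1.continuous)
    (show (1 : G) ∈ φ.1 ⁻¹' {0} from contOneCocycles.apply_one φ)
  haveI := hL₀fin
  haveI := hL₀normal
  -- the finite set of coordinates: values of `c`, coefficients of `V`, entries of `C`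
  haveI : CompactSpace G := isCompact_iff_compactSpace.mp hGc.isCompact
  have hfin_range : (Set.range φ.1).Finite := (isCompact_range φ.1.continuous).finite_of_discrete
  set S₀ : Set (AlgebraicClosure (v.adicCompletion K)) :=
    {z | ∃ P ∈ Set.range c, ∃ x y, ∃ h : (W₀.baseChange (AlgebraicClosure (v.adicCompletion K))).toAffine.Nonsingular x y,
        P = .some x y h ∧ (z = x ∨ z = y)} ∪ ({(C.u : (AlgebraicClosure (v.adicCompletion K))), C.r, C.s, C.t} : Set (AlgebraicClosure (v.adicCompletion K))) with hS₀def
  have hfin_c : (Set.range c).Finite :=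
    Set.Finite.subset (hfin_range.image Φ) (by rintro _ ⟨g, rfl⟩; exact ⟨φ.1 g, ⟨g, rfl⟩, rfl⟩)
  have hS₀fin : S₀.Finite := Set.Finite.union (finite_coords hfin_c) (Set.toFinite _)
  haveI : Finite S₀ := hS₀fin.to_subtype
  haveI hS₀fd : FiniteDimensional (v.adicCompletion K) (IntermediateField.adjoin (v.adicCompletion K) S₀) :=
    IntermediateField.finiteDimensional_adjoin fun z _ ↦
      (Algebra.IsAlgebraic.isAlgebraic (R := (v.adicCompletion K)) z).isIntegral
  set M₀ : IntermediateField (v.adicCompletion K) (AlgebraicClosure (v.adicCompletion K)) := L₀ ⊔ IntermediateField.adjoin (v.adicCompletion K) S₀ with hM₀def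
  haveI : FiniteDimensional (v.adicCompletion K) M₀ := IntermediateField.finiteDimensional_sup _ _
  set M₁ : IntermediateField (v.adicCompletion K) (AlgebraicClosure (v.adicCompletion K)) := IntermediateField.normalClosure (v.adicCompletion K) M₀ (AlgebraicClosure (v.adicCompletion K)) with hM₁def
  haveI hM₁fd : FiniteDimensional (v.adicCompletion K) M₁ := by rw [hM₁def]; infer_instance
  haveI hM₁n : Normal (v.adicCompletion K) M₁ := by rw [hM₁def]; infer_instance
  have hM₀M₁ : M₀ ≤ M₁ := by rw [hM₁def]; exact IntermediateField.le_normalClosure M₀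
  have hL₀M₁ : L₀ ≤ M₁ := by
    refine le_trans ?_ hM₀M₁
    rw [hM₀def]; exact le_sup_left
  have hS₀M₁ : S₀ ⊆ (M₁ : Set (AlgebraicClosure (v.adicCompletion K))) := by
    refine (IntermediateField.subset_adjoin (v.adicCompletion K) S₀).trans ?_
    have h : IntermediateField.adjoin (v.adicCompletion K) S₀ ≤ M₁ := le_trans (by rw [hM₀def]; exact le_sup_right) hM₀M₁
    exact h
  -- the open normal subgroup `O = Gal(K̄_v/M₁)` and `U = G ∩ O`
  set O : Subgroup (absoluteGaloisGroup (v.adicCompletion K)) := M₁.fixingSubgroup.comap (absoluteGaloisGroup.toAlgEquiv (v.adicCompletion K)).toMonoidHom with hOdef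
  have hO_mem : ∀ τ, τ ∈ O ↔ absoluteGaloisGroup.toAlgEquiv (v.adicCompletion K) τ ∈ M₁.fixingSubgroup := fun _ ↦ Subgroup.mem_comap
  have hOopen : IsOpen (O : Set (absoluteGaloisGroup (v.adicCompletion K))) := M₁.fixingSubgroup_isOpen
  set U : Subgroup G := O.subgroupOf G with hUdef
  haveI : Finite (G ⧸ U) := finite_quotient_subgroupOf_fixingSubgroup M₁ G
  letI : Fintype (G ⧸ U) := Fintype.ofFinite _
  have hUt : ∀ u : G, u ∈ U → φ.1 u = 0 := fun u hu ↦ hL₀sub u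
    (IntermediateField.fixingSubgroup_le hL₀M₁ ((hO_mem _).mp (Subgroup.mem_subgroupOf.mp hu)))
  have hcU : ∀ u ∈ U, c u = 0 := fun u hu ↦ by rw [hc_apply, hUt u hu, map_zero]
  -- §D the bound `ρ₀` and the FACT
  set ρ₀ : ℝ≥0 := hfin_range.toFinset.sup fun P ↦ w (Φ P).zCoord with hρ₀def
  have hρ₀lt : ρ₀ < 1 := by
    rw [hρ₀def, Finset.sup_lt_iff (bot_lt_iff_ne_bot.mpr one_ne_zero)]
    intro P hP
    obtain ⟨g, rfl⟩ := hfin_range.mem_toFinset.mp hP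
    exact val_zCoord_lt_one (hcK g)
  have hcρ₀ : ∀ g, w (c g).zCoord ≤ ρ₀ :=
    fun g ↦ Finset.le_sup (f := fun P ↦ w (Φ P).zCoord) (hfin_range.mem_toFinset.mpr ⟨g, rfl⟩)
  have hsqrt : NNReal.sqrt ρ₀ < 1 := by rw [← NNReal.sqrt_one]; exact NNReal.sqrt_lt_sqrt.mpr hρ₀lt
  obtain ⟨x, hx1, hxU, hxtr⟩ := hDR K p κ hκ v hpv w hw G hGc hGκ O hOopen (NNReal.sqrt ρ₀) hsqrt
  -- the trace and the contraction rate
  have hsum_eq : (∑ q : G ⧸ U, σ ((q.out : G) : (absoluteGaloisGroup (v.adicCompletion K))) x) =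
      ∑ q : G ⧸ O.subgroupOf G, ((q.out : G) : (absoluteGaloisGroup (v.adicCompletion K))) • x := rfl
  have hηpos : 0 < w (∑ q : G ⧸ U, σ ((q.out : G) : (absoluteGaloisGroup (v.adicCompletion K))) x) := lt_of_le_of_lt zero_le (hsum_eq ▸ hxtr)
  have hη2 : ρ₀ < w (∑ q : G ⧸ U, σ ((q.out : G) : (absoluteGaloisGroup (v.adicCompletion K))) x) ^ 2 := by
    rw [hsum_eq]
    exact NNReal.sqrt_lt_sqrt.mp (by rw [NNReal.sqrt_sq]; exact hxtr :
      NNReal.sqrt ρ₀ < NNReal.sqrt (w (∑ q : G ⧸ O.subgroupOf G, ((q.out : G) : (absoluteGaloisGroup (v.adicCompletion K))) • x) ^ 2))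
  -- §E the finite `G`-stable layer `Kn ∋ x` fixed by `U`
  set orb : Set (AlgebraicClosure (v.adicCompletion K)) := Set.range fun q : G ⧸ U ↦ ((q.out : G) : (absoluteGaloisGroup (v.adicCompletion K))) • x with horbdef
  haveI : Finite orb := Set.finite_range _ |>.to_subtype
  haveI : FiniteDimensional (v.adicCompletion K) (IntermediateField.adjoin (v.adicCompletion K) orb) :=
    IntermediateField.finiteDimensional_adjoin fun z _ ↦
      (Algebra.IsAlgebraic.isAlgebraic (R := (v.adicCompletion K)) z).isIntegral
  set Kn : IntermediateField (v.adicCompletion K) (AlgebraicClosure (v.adicCompletion K)) := M₁ ⊔ IntermediateField.adjoin (v.adicCompletion K) orb with hKndef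
  haveI hKnfd : FiniteDimensional (v.adicCompletion K) Kn := IntermediateField.finiteDimensional_sup _ _
  have hM₁Kn : M₁ ≤ Kn := le_sup_left
  -- `x ∈ orb`; `G`-stability of `Kn`; `U` fixes `Kn` pointwise (`GoodModelKernelH1Layer`)
  have hxorb : x ∈ orb := by
    have h := smul_mem_range_out_smul M₁ G x hxU (1 : G)
    rw [Subgroup.coe_one, one_smul] at h
    exact h
  have hxKn : x ∈ Kn := (le_sup_right : _ ≤ Kn) (IntermediateField.subset_adjoin _ _ hxorb)
  have hKnG : ∀ g : G, ∀ z ∈ Kn, (g : (absoluteGaloisGroup (v.adicCompletion K))) • z ∈ Kn :=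
    fun g z hz ↦ smul_mem_orbitLayer M₁ G x hxU g hz
  have hUKn : ∀ u : G, u ∈ U → ∀ z ∈ Kn, (u : (absoluteGaloisGroup (v.adicCompletion K))) • z = z :=
    fun u hu z hz ↦ smul_eq_self_of_mem_orbitLayer M₁ G x hxU ⟨Subgroup.mem_subgroupOf.mp hu, u.2⟩ hz
  -- `Gal(K̄_v/Kn)` fixes `C` (entries of `C` lie in `M₁ ≤ Kn`)
  have hKnC : ∀ τ : (absoluteGaloisGroup (v.adicCompletion K)), absoluteGaloisGroup.toAlgEquiv (v.adicCompletion K) τ ∈ Kn.fixingSubgroup → C.map ((absoluteGaloisGroup.toAlgEquiv (v.adicCompletion K) τ : (AlgebraicClosure (v.adicCompletion K)) ≃ₐ[(v.adicCompletion K)] (AlgebraicClosure (v.adicCompletion K))) : (AlgebraicClosure (v.adicCompletion K)) →+* (AlgebraicClosure (v.adicCompletion K))) = C := by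
    intro τ hτ
    rw [IntermediateField.mem_fixingSubgroup_iff] at hτ
    have hfix : ∀ z ∈ S₀, (absoluteGaloisGroup.toAlgEquiv (v.adicCompletion K) τ) z = z := fun z hz ↦ hτ z (hM₁Kn (hS₀M₁ hz))
    have hu : (absoluteGaloisGroup.toAlgEquiv (v.adicCompletion K) τ) (C.u : (AlgebraicClosure (v.adicCompletion K))) = C.u := hfix _ (Or.inr (by simp))
    have hr : (absoluteGaloisGroup.toAlgEquiv (v.adicCompletion K) τ) C.r = C.r := hfix _ (Or.inr (by simp))
    have hs : (absoluteGaloisGroup.toAlgEquiv (v.adicCompletion K) τ) C.s = C.s := hfix _ (Or.inr (by simp))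
    have ht' : (absoluteGaloisGroup.toAlgEquiv (v.adicCompletion K) τ) C.t = C.t := hfix _ (Or.inr (by simp))
    exact variableChange_map_eq_of_apply_eq C _ hu hr hs ht'
  -- §F the subgroup `Rat` of points fixed by `Gal(K̄_v/Kn)` and its description by coordinates
  set Rat : AddSubgroup (W₀.baseChange (AlgebraicClosure (v.adicCompletion K))).toAffine.Point :=
    { carrier := {P | ∀ τ : (absoluteGaloisGroup (v.adicCompletion K)), absoluteGaloisGroup.toAlgEquiv (v.adicCompletion K) τ ∈ Kn.fixingSubgroup → T τ P = P}
      add_mem' := fun {P Q} hP hQ τ hτ ↦ by rw [map_add, hP τ hτ, hQ τ hτ]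
      zero_mem' := fun τ _ ↦ map_zero _
      neg_mem' := fun {P} hP τ hτ ↦ by rw [map_neg, hP τ hτ] } with hRatdef
  have hRat_mem : ∀ P, P ∈ Rat ↔ ∀ τ : (absoluteGaloisGroup (v.adicCompletion K)), absoluteGaloisGroup.toAlgEquiv (v.adicCompletion K) τ ∈ Kn.fixingSubgroup → T τ P = P := fun _ ↦ Iff.rfl
  have hKn_mem : ∀ z : (AlgebraicClosure (v.adicCompletion K)), z ∈ Kn ↔ ∀ τ : (absoluteGaloisGroup (v.adicCompletion K)), absoluteGaloisGroup.toAlgEquiv (v.adicCompletion K) τ ∈ Kn.fixingSubgroup → σ τ z = z :=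
    fun z ↦ mem_iff_forall_smul_eq Kn z
  have hRat_coords : ∀ {X Y : (AlgebraicClosure (v.adicCompletion K))} {h : (W₀.baseChange (AlgebraicClosure (v.adicCompletion K))).toAffine.Nonsingular X Y},
      (.some X Y h) ∈ Rat ↔ X ∈ Kn ∧ Y ∈ Kn := by
    intro X Y h
    rw [hRat_mem, hKn_mem, hKn_mem]
    constructor
    · intro hP
      refine ⟨fun τ hτ ↦ ?_, fun τ hτ ↦ ?_⟩ <;>
      · obtain ⟨h', e⟩ := hTsome τ (hKnC τ hτ) (x := X) (y := Y) (h := h)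
        have := (e.symm.trans (hP τ hτ))
        simp only [WeierstrassCurve.Affine.Point.some.injEq] at this
        first | exact this.1 | exact this.2
    · rintro ⟨hX, hY⟩ τ hτ
      obtain ⟨h', e⟩ := hTsome τ (hKnC τ hτ) (x := X) (y := Y) (h := h)
      rw [e]
      exact point_some_eq_some (hX τ hτ) (hY τ hτ)
  -- §G the remaining inputs of the engine
  have hRatU' : ∀ u : G, u ∈ U → absoluteGaloisGroup.toAlgEquiv (v.adicCompletion K) (u : (absoluteGaloisGroup (v.adicCompletion K))) ∈ Kn.fixingSubgroup := by
    intro u hu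
    rw [IntermediateField.mem_fixingSubgroup_iff]
    exact hUKn u hu
  have hRatT : ∀ g : G, ∀ P ∈ Rat, T (g : (absoluteGaloisGroup (v.adicCompletion K))) P ∈ Rat := by
    intro g P hP
    rcases P with _ | ⟨X, Y, h⟩
    · rw [← WeierstrassCurve.Affine.Point.zero_def, map_zero]; exact Rat.zero_mem
    · obtain ⟨hX, hY⟩ := hRat_coords.mp hP
      obtain ⟨h', e⟩ := hTsome _ (hGC' g) (x := X) (y := Y) (h := h)
      rw [e, hRat_coords, hσ, hσ]
      exact ⟨hKnG g X hX, hKnG g Y hY⟩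
  have hRatz : ∀ P ∈ Rat, P ∈ kernel w (W₀.baseChange (AlgebraicClosure (v.adicCompletion K))) → P.zCoord ∈ Kn.toSubfield := by
    intro P hP _
    rcases P with _ | ⟨X, Y, h⟩
    · rw [← WeierstrassCurve.Affine.Point.zero_def, WeierstrassCurve.Affine.Point.zCoord_zero]
      exact Kn.toSubfield.zero_mem
    · obtain ⟨hX, hY⟩ := hRat_coords.mp hP
      rw [WeierstrassCurve.Affine.Point.zCoord_some]
      exact Kn.toSubfield.div_mem (Kn.toSubfield.neg_mem hX) hY
  have hlift : ∀ z ∈ Kn.toSubfield, w z < 1 →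
      ∃ P ∈ kernel w (W₀.baseChange (AlgebraicClosure (v.adicCompletion K))), P ∈ Rat ∧ P.zCoord = z := by
    intro z hz hz1
    obtain ⟨P, hPK, hPz⟩ :=
      exists_mem_kernel_zCoord_eq_of_isAlgClosed (V := W₀.baseChange (AlgebraicClosure (v.adicCompletion K))) (w := w) hz1
    refine ⟨P, hPK, (hRat_mem P).mpr fun τ hτ ↦ ?_, hPz⟩
    obtain ⟨hTK, hTz⟩ := hTC_ker τ (hKnC τ hτ) P hPK
    refine eq_of_mem_kernel_of_zCoord_eq hTK hPK ?_
    rw [hTz, hPz]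
    rw [IntermediateField.mem_fixingSubgroup_iff] at hτ
    exact hτ z hz
  have hcomplete : ∀ θ : ℝ≥0, θ < 1 → ∀ a : ℕ → (AlgebraicClosure (v.adicCompletion K)),
      (∀ r, a r ∈ Kn.toSubfield) → (∀ r, w (a (r + 1) - a r) ≤ θ ^ (r + 1)) →
      ∃ z ∈ Kn.toSubfield, ∀ r, w (z - a r) ≤ θ ^ (r + 1) := by
    intro θ hθ a ha hcau
    obtain ⟨y, hy⟩ := exists_limit_of_finiteDimensional hw Kn hθ (fun r ↦ ⟨a r, ha r⟩) hcau
    exact ⟨y, y.2, hy⟩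
  have hcR : ∀ g, c g ∈ Rat := by
    intro g
    rcases hQ : c g with _ | ⟨X, Y, h⟩
    · exact Rat.zero_mem
    · rw [hRat_coords]
      have hXS : X ∈ S₀ := Or.inl ⟨c g, ⟨g, rfl⟩, X, Y, h, hQ, Or.inl rfl⟩
      have hYS : Y ∈ S₀ := Or.inl ⟨c g, ⟨g, rfl⟩, X, Y, h, hQ, Or.inr rfl⟩
      exact ⟨hM₁Kn (hS₀M₁ hXS), hM₁Kn (hS₀M₁ hYS)⟩
  obtain ⟨θ, hθ1, hρ₀θ⟩ : ∃ θ : ℝ≥0, θ < 1 ∧ ρ₀ = w (∑ q : G ⧸ U, σ ((q.out : G) : (absoluteGaloisGroup (v.adicCompletion K))) x) ^ 2 * θ := by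
    have hη2pos : 0 < w (∑ q : G ⧸ U, σ ((q.out : G) : (absoluteGaloisGroup (v.adicCompletion K))) x) ^ 2 := pow_pos hηpos 2
    exact ⟨ρ₀ / _ ^ 2, by rw [div_lt_one hη2pos]; exact hη2, by rw [mul_div_cancel₀ _ hη2pos.ne']⟩
  have hcz : ∀ g, w (c g).zCoord ≤ w (∑ q : G ⧸ U, σ ((q.out : G) : (absoluteGaloisGroup (v.adicCompletion K))) x) ^ 2 * θ :=
    fun g ↦ hρ₀θ ▸ hcρ₀ g
  -- §H the engine
  obtain ⟨P, hPK, -, hP⟩ := AlmostEtale.exists_forall_eq_sub_of_cocycle_of_trace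
    (V := W₀.baseChange (AlgebraicClosure (v.adicCompletion K))) (w := w) (U := U) (σ := fun g : G ↦ σ (g : (absoluteGaloisGroup (v.adicCompletion K))))
    (T := fun g : G ↦ T (g : (absoluteGaloisGroup (v.adicCompletion K)))) (S := Kn.toSubfield) (Rat := Rat) (x := x)
    (fun g h z ↦ by rw [Subgroup.coe_mul, hσ, hσ, hσ, mul_smul]) (fun g z ↦ hσw _ z)
    (fun g h Q ↦ by rw [Subgroup.coe_mul]; exact hTmul _ _ Q)
    (fun g Q hQ ↦ (hTC_ker _ (hGC' g) Q hQ).1) (fun g Q hQ ↦ (hTC_ker _ (hGC' g) Q hQ).2)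
    (fun g s hs ↦ by rw [hσ]; exact hKnG g s hs) (fun u hu s hs ↦ by rw [hσ]; exact hUKn u hu s hs)
    hRatT (fun u hu Q hQ ↦ hQ _ (hRatU' u hu)) hRatz hlift hcomplete hx1 hxKn hηpos hθ1
    hcoc hcK hcR hcU hcz
  -- §I conclusion
  refine ⟨Φ.symm P, ?_, fun g ↦ ?_⟩
  · rw [← hΦ, AddEquiv.apply_symm_apply, mem_kernelOfReduction_iff, ← mem_kernel_iff_reducesToZero W₀]
    exact hPK
  · apply Φ.injective
    rw [map_sub, ← hc_apply, hP g, hT, AddEquiv.apply_symm_apply]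
    rfl

/-- **The record `CoatesGreenberg1996.H1_goodModelKernel_trivial` (A254: [CoGr] Cor. 3.2 in good-model
cocycle form; `hCG` of the Route-2 e346 ENDs, of S2 / A239 / A111 / (I2), of T-CG-SS) DERIVED from
the trace form of "deeply ramified"** (`exists_eq_smul_sub_of_deeplyRamifiedTrace` with the record's
binders). Registry: A254 DERIVED modulo `deeplyRamified_cyclotomic_trace`; NOT a discharge of
Tate–Sen / [CoGr] §2. Consumers may switch `hCG ↦ H1_goodModelKernel_trivial_of_deeplyRamifiedTrace hDR`.
[cite: CoatesGreenberg1996, §3 Cor. 3.2 (through GreenbergLNM1716 pp. 36–37 (74), 83–84) ⇐ §2 p. 143 / Thm. 2.13 (through IovitaZaharescu1999 Thm. 1.2)] -/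
theorem H1_goodModelKernel_trivial_of_deeplyRamifiedTrace
    (hDR : deeplyRamified_cyclotomic_trace.{u}) : H1_goodModelKernel_trivial.{u} :=
  fun _K _ _ W _ p _ κ hκ _v hpv w hw C W₀ hW₀ hΔ G hGc hGκ hGC φ hφ ↦
    exists_eq_smul_sub_of_deeplyRamifiedTrace hDR W p κ hκ hpv w hw C W₀ hW₀ hΔ G hGc hGκ hGC φ hφ

/-- **(I2) from the deeply-ramified trace fact**: the supersingular-lane record
`WeierstrassCurve.CoatesGreenberg1996_H1_formalGroup_trivial` (`H¹(K_∞K_v, 𝓕(𝔪̄)) = 0` for the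
minimal model of a curve with good reduction at `v ∣ p`, Greenberg LNM 1716 p. 83, input `h2` of
Thm. 1.7) — already DERIVED from A254 by `…_of_goodModelKernel` — is now derived from
`deeplyRamified_cyclotomic_trace`. [cite: GreenbergLNM1716, §2 p. 83 ("special case of Corollary 3.2 in [CoGr]")] -/
theorem CoatesGreenberg1996_H1_formalGroup_trivial_of_deeplyRamifiedTrace
    (hDR : deeplyRamified_cyclotomic_trace.{u}) : CoatesGreenberg1996_H1_formalGroup_trivial.{u} :=
  CoatesGreenberg1996_H1_formalGroup_trivial_of_goodModelKernel
    (H1_goodModelKernel_trivial_of_deeplyRamifiedTrace hDR)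

end Main

end Literature.NumberTheory.EllipticCurves.CoatesGreenberg1996.GoodModelLine.KernelH1

end Part3

/-! ## Part 4 — the EXACT discharges (universe `0`) -/

namespace Literature.NumberTheory.EllipticCurves.CoatesGreenberg1996

/-- **[CoGr] Cor. 3.2 for good models HOLDS (universe `0`)** — the named fact
`CoatesGreenberg1996.H1_goodModelKernel_trivial` (`H¹(L, Ŵ₀(𝔪̄)) = 0` in cocycle form for a good model
`W₀ = C • E ⊗ K̄_v`, every closed `G ≤ (ker κ)_v` fixing `C`): the almost-étale successive approximation
`GoodModelLine.KernelH1.H1_goodModelKernel_trivial_of_deeplyRamifiedTrace` (Part 3) fed with the trace form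
of "deeply ramified" `deeplyRamified_cyclotomic_trace_holds` (file `CyclotomicZpExtensionDeeplyRamifiedProofs`
§4: the base instance `deeplyRamified_cyclotomicZpExtension_trace_holds`, Tate's almost étale lemma, through the
reduction `deeplyRamified_cyclotomic_trace_of_cyclotomicZpExtension`; Coates–Greenberg §2 p. 143 (iii) /
Thm. 2.13).  Honest scope:
universe `0` (the PAdicHodge framework is typed over `F : Type`).  Summits-side twin:
`Summit.BirchSwinnertonDyer.BirchSwinnertonDyer.Theorems.H1_goodModelKernel_trivial_holds`.
[cite: CoatesGreenberg1996, §3 Cor. 3.2 with Thm. 3.1 and §2 p. 143 / Thm. 2.13 (through GreenbergLNM1716 pp. 83–84 and IovitaZaharescu1999 Thm. 1.2)]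
[cite: Bondarko2007FormalGroupsSurvey, §9.2 Thm. 9.2] [cite: Tate1967, §3.2 Prop. 9] -/
theorem H1_goodModelKernel_trivial_holds : H1_goodModelKernel_trivial.{0} :=
  GoodModelLine.KernelH1.H1_goodModelKernel_trivial_of_deeplyRamifiedTrace
    deeplyRamified_cyclotomic_trace_holds

end Literature.NumberTheory.EllipticCurves.CoatesGreenberg1996

/-- **Greenberg's input (I2) at a supersingular prime HOLDS (universe `0`)** — the named fact
`WeierstrassCurve.CoatesGreenberg1996_H1_formalGroup_trivial` (`H¹(K_v K_∞, 𝓕(𝔪̄)) = 0`, Coates–Greenberg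
1996 Cor. 3.2 as quoted in Greenberg LNM 1716 p. 83): Part 3's
`GoodModelLine.KernelH1.CoatesGreenberg1996_H1_formalGroup_trivial_of_deeplyRamifiedTrace` (the record for
good models composed with the tree's reduction `CoatesGreenberg1996_H1_formalGroup_trivial_of_goodModelKernel`)
fed with `deeplyRamified_cyclotomic_trace_holds`.  Honest scope: universe `0`.  Summits-side twin:
`Summit.BirchSwinnertonDyer.BirchSwinnertonDyer.Theorems.CoatesGreenberg1996_H1_formalGroup_trivial_holds`.
[cite: CoatesGreenberg1996, Cor. 3.2 with Thm. 2.13] [cite: GreenbergLNM1716, §2 p. 83] [cite: Tate1967, §3.2 Prop. 9] -/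
theorem WeierstrassCurve.CoatesGreenberg1996_H1_formalGroup_trivial_holds :
    WeierstrassCurve.CoatesGreenberg1996_H1_formalGroup_trivial.{0} :=
  Literature.NumberTheory.EllipticCurves.CoatesGreenberg1996.GoodModelLine.KernelH1.CoatesGreenberg1996_H1_formalGroup_trivial_of_deeplyRamifiedTrace
    Literature.NumberTheory.EllipticCurves.CoatesGreenberg1996.deeplyRamified_cyclotomic_trace_holds
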